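import Literature.MathematicalPhysics.QuantumLattice.SectorEigenvalueContinuation
import Literature.MathematicalPhysics.QuantumLattice.HubbardRingPerronFrobeniusProofs
import Literature.MathematicalPhysics.QuantumLattice.HubbardModelThermodynamicLimitProofs
import HarnessLib

/-!
# Lieb–Wu's continuity principle for the ground state of the Hubbard ring (proofs)

Family `hubbard` (trunk T-QLATTICE), statement hubbard.S10 (`Literature.MathematicalPhysics.QuantumLattice.lieb_wu`). Lieb and Wu
(Physica A 321 (2003) 1, §2) deduce from the uniqueness of the ground state of the sector
`(M, M')`, `M, M'` odd (their item 1., PROVED in `HubbardRingPerronFrobeniusProofs`), the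
principle by which the Bethe-ansatz state is to be identified with the ground state: "Suppose
that we know the ground state for some particular value of `U` ... and suppose we have a
`U`-dependent solution ... with an energy `E(U)` such that (a) `E` is the known ground state
energy [there] and (b) `E(U)` is continuous on the interval. Then `E(U)` is necessarily the
ground state energy in that interval." This file PROVES it for the Hubbard Hamiltonian
(`SectorEigenvalueContinuation` supplies the abstract spectral lemma):

* `Literature.MathematicalPhysics.QuantumLattice.eigenvalue_eq_minEnergyOn_szSector` — general graph `G`, sector
  `(N, S^z) = (2n, 0)`, `n ≤ |Λ|`, assuming the ground state of the sector is unique up to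
  scalars for every coupling in the preconnected set `S`: a continuous eigenvalue curve `E` on
  `S` with eigenvectors in the sector, equal to the sector minimum at one `U₀ ∈ S`, equals the
  sector minimum on all of `S`.
* `Literature.MathematicalPhysics.QuantumLattice.liebWu_eigenvalue_continuation` — the Hubbard ring `fermionTorusGraph 1 L`,
  `t > 0`, `n` odd (`M = M' = n`), where uniqueness holds for every real `U`
  (`liebWu_isGroundStateInSector_ring`): the printed statement.

Ingredients: the Hamiltonian is Hermitian and block diagonal in `(N↑, N↓)`
(`LiebThm1.hamiltonian_isHermitian`, `LiebThm1.preservesSectors_hamiltonian`); its energies are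
`|Λ|`-Lipschitz in `U` on unit vectors (`⟨ψ, H_U ψ⟩ - ⟨ψ, H_{U'} ψ⟩ = (U - U') Σ_x ⟨ψ, n_{x↑}n_{x↓} ψ⟩`
with `0 ≤ ⟨ψ, n_{x↑} n_{x↓} ψ⟩ ≤ ‖ψ‖²`); ground states of the sector exist
(`szSector_groundState`). This is the reduction used in the printed strategy for node F2c of
`LiebWuBetheAnsatz` (Lieb–Wu 2003, §3 (a)–(b); Goldbaum 2005, §4): it remains to produce a
connected family of Bethe-ansatz eigenvectors reaching a coupling where the ground state is known.

## Sources

* E. H. Lieb, F. Y. Wu, *The one-dimensional Hubbard model: a reminiscence*, Physica A 321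
  (2003) 1–27 = arXiv:cond-mat/0207529 (held; key `LiebWuPhysicaA2003`), §2 (items 1.–2. and
  the paragraph following them), §3 (a)–(b).
* P. S. Goldbaum, CMP 258 (2005) 317 = arXiv:cond-mat/0403736 (key `Goldbaum2005`), §4.
-/

namespace Literature.MathematicalPhysics.QuantumLattice

open Matrix Finset

variable {Λ : Type*} [LinearOrder Λ] [Fintype Λ]

/-- The density–density expectation is bounded by the norm: `Re ⟨ψ, n_{x↑} n_{x↓} ψ⟩ ≤ ‖ψ‖²`
(`n_{x↑} n_{x↓}` is a diagonal `0/1` matrix in the occupation basis). [folklore] -/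
theorem re_dotProduct_numberOp_numberOp_le (ψ : Fock (Orb Λ)) (x : Λ) :
    (star ψ ⬝ᵥ (numberOp x 0 *ᵥ (numberOp x 1 *ᵥ ψ))).re ≤ (star ψ ⬝ᵥ ψ).re := by
  rw [← Literature.MathematicalPhysics.QuantumLattice.numberAt_orb, ← Literature.MathematicalPhysics.QuantumLattice.numberAt_orb, Literature.MathematicalPhysics.QuantumLattice.numberAt_eq_diagonal,
    Literature.MathematicalPhysics.QuantumLattice.numberAt_eq_diagonal]
  simp only [dotProduct, mulVec_diagonal, Pi.star_apply, Complex.re_sum]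
  refine Finset.sum_le_sum fun s _ => ?_
  have h0 : 0 ≤ (star (ψ s) * ψ s).re := by
    rw [Complex.star_def, Complex.conj_mul', ← Complex.ofReal_pow, Complex.ofReal_re]
    positivity
  split_ifs <;> simp only [one_mul, zero_mul, mul_zero, Complex.zero_re, le_refl, h0]

variable (G : SimpleGraph Λ) [DecidableRel G.Adj]

/-- **The energies of the Hubbard Hamiltonian are `|Λ|`-Lipschitz in `U`:**
`|Re ⟨ψ, H_U ψ⟩ - Re ⟨ψ, H_{U'} ψ⟩| ≤ |Λ| |U - U'| ‖ψ‖²`, since the two differ by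
`(U - U') Σ_x ⟨ψ, n_{x↑} n_{x↓} ψ⟩`. [folklore] -/
theorem abs_re_expect_hamiltonian_sub_le (t U U' : ℝ) (ψ : Fock (Orb Λ)) :
    |(star ψ ⬝ᵥ hamiltonian G t U *ᵥ ψ).re - (star ψ ⬝ᵥ hamiltonian G t U' *ᵥ ψ).re| ≤
      Fintype.card Λ * |U - U'| * (star ψ ⬝ᵥ ψ).re := by
  set D : ℂ := ∑ x : Λ, star ψ ⬝ᵥ (numberOp x 0 *ᵥ (numberOp x 1 *ᵥ ψ)) with hD
  have hdiff : (star ψ ⬝ᵥ hamiltonian G t U *ᵥ ψ).re - (star ψ ⬝ᵥ hamiltonian G t U' *ᵥ ψ).re =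
      (U - U') * D.re := by
    rw [ThermodynamicLimit.dotProduct_hamiltonian_mulVec G t U ψ,
      ThermodynamicLimit.dotProduct_hamiltonian_mulVec G t U' ψ, ← hD]
    simp only [Complex.add_re, Complex.re_ofReal_mul]
    ring
  have hD0 : 0 ≤ D.re := by
    rw [hD, Complex.re_sum]
    exact Finset.sum_nonneg fun x _ => ThermodynamicLimit.re_dotProduct_numberOp_numberOp_nonneg ψ x
  have hDle : D.re ≤ Fintype.card Λ * (star ψ ⬝ᵥ ψ).re := by
    rw [hD, Complex.re_sum]
    calc ∑ x : Λ, (star ψ ⬝ᵥ (numberOp x 0 *ᵥ (numberOp x 1 *ᵥ ψ))).re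
        ≤ ∑ _x : Λ, (star ψ ⬝ᵥ ψ).re := Finset.sum_le_sum fun x _ => re_dotProduct_numberOp_numberOp_le ψ x
      _ = Fintype.card Λ * (star ψ ⬝ᵥ ψ).re := by simp
  rw [hdiff, abs_mul, abs_of_nonneg hD0]
  calc |U - U'| * D.re ≤ |U - U'| * (Fintype.card Λ * (star ψ ⬝ᵥ ψ).re) :=
        mul_le_mul_of_nonneg_left hDle (abs_nonneg _)
    _ = Fintype.card Λ * |U - U'| * (star ψ ⬝ᵥ ψ).re := by ring

/-- **Continuity principle, general graph** (Lieb–Wu 2003, §2, given uniqueness). In the sector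
`(N, S^z) = (2n, 0)` (`n ≤ |Λ|`) of the Hubbard Hamiltonian on `G`, suppose the ground state is
unique up to scalars for every coupling `U` in a preconnected set `S`. If `E` is continuous on
`S`, `E U` is an eigenvalue of `H_U` on a nonzero vector of the sector for every `U ∈ S`, and
`E U₀` is the lowest energy of the sector for one `U₀ ∈ S`, then `E U` is the lowest energy of
the sector for every `U ∈ S`. [cite: LiebWuPhysicaA2003, §2] -/
theorem eigenvalue_eq_minEnergyOn_szSector (t : ℝ) {n : ℕ} (hn : n ≤ Fintype.card Λ) {S : Set ℝ}
    (hS : IsPreconnected S)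
    (huniq : ∀ U ∈ S, ∀ ψ₁ ψ₂, IsGroundStateInSector (hamiltonian G t U) (2 * n) 0 ψ₁ →
      IsGroundStateInSector (hamiltonian G t U) (2 * n) 0 ψ₂ → ∃ c : ℂ, ψ₂ = c • ψ₁)
    {E : ℝ → ℝ} (hE : ContinuousOn E S)
    (hev : ∀ U ∈ S, ∃ φ ∈ szSector (2 * n) 0, φ ≠ 0 ∧
      hamiltonian G t U *ᵥ φ = (E U : ℂ) • φ)
    {U₀ : ℝ} (hU₀ : U₀ ∈ S)
    (h0 : E U₀ = (hamiltonian G t U₀).minEnergyOn (szSector (2 * n) 0)) :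
    ∀ U ∈ S, E U = (hamiltonian G t U).minEnergyOn (szSector (2 * n) 0) := by
  refine eigenvalue_eq_sectorMin_of_continuousOn (szSector (2 * n) 0) (fun U => hamiltonian G t U)
    (fun U => (hamiltonian G t U).minEnergyOn (szSector (2 * n) 0)) E S
    (d := Fintype.card Λ) (Nat.cast_nonneg _) (fun U _ => (LiebThm1.hamiltonian_isHermitian G t U).eq)
    (fun U _ v hv => ?_) (fun U _ U' _ v _ => abs_re_expect_hamiltonian_sub_le G t U U' v)
    (fun U _ v hv => ?_) (fun U _ => ?_) (fun U hU ψ₁ hψ₁ ψ₂ hψ₂ hψ₁0 h₁ h₂ => ?_) hS hE hev hU₀ h0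
  · -- invariance of the sector
    rw [mem_szSector_two_mul_zero_iff] at hv ⊢
    exact (LiebThm1.preservesSectors_hamiltonian G t U).isInSector_mulVec hv
  · -- variational bound
    have h := (szSector_groundState G t U hn).2 v ((mem_szSector_two_mul_zero_iff n v).1 hv)
    simpa [expect] using h
  · -- existence of a ground state
    obtain ⟨⟨ψ, hψ, hψ0, hHψ⟩, -⟩ := szSector_groundState G t U hn
    exact ⟨ψ, hψ, hψ0, hHψ⟩
  · -- uniqueness
    by_cases hψ₂0 : ψ₂ = 0
    · exact ⟨0, by rw [hψ₂0, zero_smul]⟩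
    · exact huniq U hU ψ₁ ψ₂ ⟨hψ₁, hψ₁0, h₁⟩ ⟨hψ₂, hψ₂0, h₂⟩

/-- **Lieb–Wu's continuity principle for the Hubbard ring** (Physica A 321 (2003) 1, §2: "The
uniqueness statement 1. is important for the following reason. Suppose that we know the ground
state for some particular value of `U` (e.g., `U = ∞`) and suppose we have a `U`-dependent
solution to (Gaudin) in some interval of `U` values (e.g., `(0, ∞)`) with an energy `E(U)` such
that: (a) `E(∞)` is the known ground state energy and (b) `E(U)` is continuous on the interval.
Then `E(U)` is necessarily the ground state energy in that interval."), in the finite-`U` form: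
on the ring of `L` sites with `t > 0`, in the sector `(N, S^z) = (2n, 0)` with `n` odd
(`M = M' = n`, where the ground state is unique for every real `U`,
`liebWu_isGroundStateInSector_ring`) and `n ≤ L`, a function `E` continuous on a preconnected set
`S` of couplings, such that every `E U` is an eigenvalue of `H_U` with an eigenvector in the
sector and `E U₀` is the sector ground-state energy for one `U₀ ∈ S`, is the sector ground-state
energy for all `U ∈ S`. [cite: LiebWuPhysicaA2003, §2] -/
theorem liebWu_eigenvalue_continuation (L : ℕ) {t : ℝ} (ht : 0 < t) {n : ℕ} (hn : Odd n)
    (hnL : n ≤ L) {S : Set ℝ} (hS : IsPreconnected S) {E : ℝ → ℝ} (hE : ContinuousOn E S)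
    (hev : ∀ U ∈ S, ∃ φ ∈ szSector (2 * n) 0, φ ≠ 0 ∧
      hamiltonian (fermionTorusGraph 1 L) t U *ᵥ φ = (E U : ℂ) • φ)
    {U₀ : ℝ} (hU₀ : U₀ ∈ S)
    (h0 : E U₀ = (hamiltonian (fermionTorusGraph 1 L) t U₀).minEnergyOn (szSector (2 * n) 0)) :
    ∀ U ∈ S, E U = (hamiltonian (fermionTorusGraph 1 L) t U).minEnergyOn (szSector (2 * n) 0) := by
  have hcard : n ≤ Fintype.card (FermionTorus 1 L) := by
    simpa [FermionTorus, Fintype.card_lex] using hnL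
  exact eigenvalue_eq_minEnergyOn_szSector (fermionTorusGraph 1 L) t hcard hS
    (fun U _ => (liebWu_isGroundStateInSector_ring L ht U hn hnL).2.1) hE hev hU₀ h0

end Literature.MathematicalPhysics.QuantumLattice
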